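import Summits.Ventures.CertifiedQuantumChemistry.Rows.HubbardRingTVWeakCoupling
import HarnessLib

/-!
# Ventures/CertifiedQuantumChemistry — Rows/HubbardRingTVHoppingBounds.lean: the hopping term is
# bounded by `2|t|·N` on every feasible pair — `OPT_DQG ≥ −2|t|(N_α + N_β)`, the free-fermion floor
# `E₀(L; t, 0) ≤ OPT_X(L; t, U)`, and `E₀`, `OPT_X` are `2(N_α + N_β)`-Lipschitz in the hopping `t`

HONEST FRAMING (verbatim): certified bounds for a stated model Hamiltonian in a stated basis; not a
claim about the real molecule beyond that model.

Seat rdm-B, ROWS courtesy file (theorems only; no `def`, no notation, no instance; zero compute). The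
`t`-side complement of `Rows/HubbardRingTVWeakCoupling.lean` (regularity in `U` with the explicit
constant `min(N_α, N_β)`): here the explicit constant in the hopping is `2(N_α + N_β)` — every site of
the ring has two neighbours and every one-matrix entry of a feasible pair is bounded by the mean of
its two diagonal entries (`γ ⪰ 0`). In place of the `Σ_st ‖Ĥ_st‖`-type constants of
`Rows/SectorEnergyConcavity.lean` / `Rows/RelaxationValueConcavity.lean`:

* §1 (abstract `Λ`) `HoppingBound.norm_oneBody_le_rowSum`, `re_oneBody_ge_neg_rowSum`: on every
  `(a, b)`-sector-feasible pair and for every one-body table with row AND column sums `Σ ‖h‖ ≤ ρ`,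
  `|Σ_pq h_pq Σ_σ γ_{pσ,qσ}| ≤ ρ·(a + b)`.
* §2 THE RING (every `L`, every sector): `hubbardRingTV_re_rdmEnergy_ge_hop` (`Re E(γ, Γ) ≥
  −2|t|(a+b) + U·s` on every sector-feasible pair, `s` the total doublon weight),
  **`hubbardRingTV_pqgSectorEnergy_ge_hop`** (`OPT_DQG(L; t, U; a, b) ≥ −2|t|(a + b)` for `U ≥ 0`),
  `hubbardRingTV_energy_ge_hop`; and the FREE-FERMION FLOOR **`hubbardRingTV_energy_zero_le_pqgSectorEnergy`**
  (`E₀(L; t, 0; a, b) ≤ OPT_DQG(L; t, U; a, b)` for `U ≥ 0`, `a, b ≤ L`: monotonicity in `U` + exactness at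
  `U = 0` — the two-positivity bound is never below the non-interacting energy of the same sector) with
  its singlet form `hubbardRingTV_energy_zero_le_pqgSingletEnergy`.
* §3 LIPSCHITZ IN THE HOPPING: `hubbardRingTV_rdmEnergy_sub_hopping` (the functional at `t′` minus at
  `t` is the one-body functional of `hubbardRingTV L (t′ − t) 0`), **`abs_hubbardRingTV_energy_sub_le_hop`**,
  **`abs_hubbardRingTV_pqgSectorEnergy_sub_le_hop`**, `abs_hubbardRingTV_pqgSingletEnergy_sub_le_hop`:
  `|X(L; t, U) − X(L; t′, U)| ≤ 2|t − t′|·(a + b)` for `X ∈ {E₀, OPT_DQG, OPT_DQG+S²}` (every `U`).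

READING: a-priori bounds on ARBITRARY feasible pairs and values of the cell's own model object; no
certificate, row, claim node or value of record depends on them. All PROVED (0 sorry, standard axioms);
no definitions, no named facts. References (docstring-only): D. A. Mazziotti, Adv. Chem. Phys. 134
(2007) ch. 3 §II.B (`γ ⪰ 0` on the two-positive set); R. A. Horn, C. R. Johnson, *Matrix Analysis*
(2013) §7.1 (entries of a PSD matrix). Tree (REUSED): `IsDQGFeasible.one_posSemidef`,
`Literature.LinearAlgebra.Matrix.norm_apply_le_of_posSemidef`, `StrongCouplingDoublon.interaction_eq`,
`StrongCouplingGap.sum_norm_hubbardRingTV_h_le`, `exists_unit_eigen_sectorGroundEnergy`,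
`sectorGroundEnergy_le_re_rayleigh_of_unit`, `rdmEnergy_rdm`, `IsDQGFeasibleSector.of_state`,
`exists_isDQGFeasible{Sector,Singlet}_rdmEnergy_eq_…`, `pqgSectorEnergy_le_rdmEnergy`,
`pqgSingletEnergy_le_rdmEnergy`, gen 36's `…_pqgSectorEnergy_mono` / `…_pqgSingletEnergy_mono`, gen 38's
`hubbardRingTV_pqgSectorEnergy_zero_repulsion` / `…_pqgSingletEnergy_zero_repulsion`.
-/

noncomputable section

namespace Summit.Ventures.CertifiedQuantumChemistry

open Matrix Finset
open Literature.MathematicalPhysics.QuantumLattice Literature.MathematicalPhysics.QuantumChemistry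
open Summit.Ventures.CertifiedQuantumChemistry.Hamiltonians
open scoped ComplexOrder

/-! ## §1 The one-body functional is bounded by `ρ·N` on every sector-feasible pair -/

namespace HoppingBound

section Abstract

variable {Λ : Type*} [LinearOrder Λ] [Fintype Λ]
variable {γ : Matrix (Orb Λ) (Orb Λ) ℂ} {Γ : Matrix (Orb Λ × Orb Λ) (Orb Λ × Orb Λ) ℂ}

/-- `‖γ_xy‖ ≤ (Re γ_xx + Re γ_yy)/2` on every DQG-feasible pair (`γ ⪰ 0`). [folklore] -/
theorem norm_one_apply_le_half {N : ℕ} (hf : IsDQGFeasible N γ Γ) (x y : Orb Λ) :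
    ‖γ x y‖ ≤ ((γ x x).re + (γ y y).re) / 2 := by
  have h := Literature.LinearAlgebra.Matrix.norm_apply_le_of_posSemidef hf.one_posSemidef x y
  simpa using h

/-- **`‖Σ_pq h_pq Σ_σ γ_{pσ,qσ}‖ ≤ ρ·(a + b)`** for every `(a, b)`-sector-feasible pair and every table
with row sums `Σ_q ‖h_pq‖ ≤ ρ` and column sums `Σ_p ‖h_pq‖ ≤ ρ`. [folklore] -/
theorem norm_oneBody_le_rowSum {a b : ℕ} (hf : IsDQGFeasibleSector a b γ Γ) {h : Λ → Λ → ℂ} {ρ : ℝ}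
    (hrow : ∀ p, ∑ q, ‖h p q‖ ≤ ρ) (hcol : ∀ q, ∑ p, ‖h p q‖ ≤ ρ) :
    ‖∑ p : Λ, ∑ q : Λ, h p q * ∑ σ : Fin 2, γ (orb p σ) (orb q σ)‖ ≤ ρ * ((a : ℝ) + b) := by
  set A : Λ → ℝ := fun p => ∑ σ : Fin 2, (γ (orb p σ) (orb p σ)).re with hA
  have hA0 : ∀ p, 0 ≤ A p := fun p => sum_nonneg fun σ _ => (hf.dqg.diag_nonneg (orb p σ)).1
  have hAN : ∑ p : Λ, A p = (a : ℝ) + b := by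
    have hu := congrArg Complex.re hf.trace_up
    have hdn := congrArg Complex.re hf.trace_down
    rw [Complex.re_sum, Complex.natCast_re] at hu hdn
    simp only [hA, Fin.sum_univ_two, Finset.sum_add_distrib, hu, hdn]
  -- termwise: `‖h_pq · Σ_σ γ_pq^σ‖ ≤ ‖h_pq‖ · (A p + A q)/2`
  have hterm : ∀ p q : Λ, ‖h p q * ∑ σ : Fin 2, γ (orb p σ) (orb q σ)‖ ≤ ‖h p q‖ * ((A p + A q) / 2) := by
    intro p q
    rw [norm_mul]
    refine mul_le_mul_of_nonneg_left ?_ (norm_nonneg _)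
    calc ‖∑ σ : Fin 2, γ (orb p σ) (orb q σ)‖ ≤ ∑ σ : Fin 2, ‖γ (orb p σ) (orb q σ)‖ := norm_sum_le _ _
      _ ≤ ∑ σ : Fin 2, ((γ (orb p σ) (orb p σ)).re + (γ (orb q σ) (orb q σ)).re) / 2 :=
          sum_le_sum fun σ _ => norm_one_apply_le_half hf.dqg _ _
      _ = (A p + A q) / 2 := by rw [hA, ← Finset.sum_div, Finset.sum_add_distrib]
  have h1 : ∑ p : Λ, ∑ q : Λ, ‖h p q‖ * A p ≤ ρ * ((a : ℝ) + b) := by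
    calc ∑ p : Λ, ∑ q : Λ, ‖h p q‖ * A p = ∑ p : Λ, A p * ∑ q : Λ, ‖h p q‖ := by
          refine Finset.sum_congr rfl fun p _ => ?_
          rw [Finset.mul_sum]
          exact Finset.sum_congr rfl fun q _ => mul_comm _ _
      _ ≤ ∑ p : Λ, A p * ρ := sum_le_sum fun p _ => mul_le_mul_of_nonneg_left (hrow p) (hA0 p)
      _ = ρ * ((a : ℝ) + b) := by rw [← Finset.sum_mul, hAN, mul_comm]
  have h2 : ∑ p : Λ, ∑ q : Λ, ‖h p q‖ * A q ≤ ρ * ((a : ℝ) + b) := by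
    rw [Finset.sum_comm]
    calc ∑ q : Λ, ∑ p : Λ, ‖h p q‖ * A q = ∑ q : Λ, A q * ∑ p : Λ, ‖h p q‖ := by
          refine Finset.sum_congr rfl fun q _ => ?_
          rw [Finset.mul_sum]
          exact Finset.sum_congr rfl fun p _ => mul_comm _ _
      _ ≤ ∑ q : Λ, A q * ρ := sum_le_sum fun q _ => mul_le_mul_of_nonneg_left (hcol q) (hA0 q)
      _ = ρ * ((a : ℝ) + b) := by rw [← Finset.sum_mul, hAN, mul_comm]
  have hsplit : ∀ p q : Λ, ‖h p q‖ * ((A p + A q) / 2) = (‖h p q‖ * A p + ‖h p q‖ * A q) / 2 :=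
    fun p q => by ring
  calc ‖∑ p : Λ, ∑ q : Λ, h p q * ∑ σ : Fin 2, γ (orb p σ) (orb q σ)‖
      ≤ ∑ p : Λ, ∑ q : Λ, ‖h p q‖ * ((A p + A q) / 2) :=
        (norm_sum_le _ _).trans (sum_le_sum fun p _ => (norm_sum_le _ _).trans (sum_le_sum fun q _ => hterm p q))
    _ = (∑ p : Λ, ∑ q : Λ, ‖h p q‖ * A p + ∑ p : Λ, ∑ q : Λ, ‖h p q‖ * A q) / 2 := by
        simp only [hsplit, ← Finset.sum_div, Finset.sum_add_distrib]
    _ ≤ ρ * ((a : ℝ) + b) := by linarith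

/-- **`Re Σ_pq h_pq Σ_σ γ_{pσ,qσ} ≥ −ρ·(a + b)`** (the real part is above minus the norm). [folklore] -/
theorem re_oneBody_ge_neg_rowSum {a b : ℕ} (hf : IsDQGFeasibleSector a b γ Γ) {h : Λ → Λ → ℂ}
    {ρ : ℝ} (hrow : ∀ p, ∑ q, ‖h p q‖ ≤ ρ) (hcol : ∀ q, ∑ p, ‖h p q‖ ≤ ρ) :
    -(ρ * ((a : ℝ) + b)) ≤ (∑ p : Λ, ∑ q : Λ, h p q * ∑ σ : Fin 2, γ (orb p σ) (orb q σ)).re := by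
  have h1 := norm_oneBody_le_rowSum hf hrow hcol
  have h2 := Complex.abs_re_le_norm (∑ p : Λ, ∑ q : Λ, h p q * ∑ σ : Fin 2, γ (orb p σ) (orb q σ))
  rw [abs_le] at h2
  linarith [h2.1]

/-- … and `≤ ρ·(a + b)`. [folklore] -/
theorem re_oneBody_le_rowSum {a b : ℕ} (hf : IsDQGFeasibleSector a b γ Γ) {h : Λ → Λ → ℂ}
    {ρ : ℝ} (hrow : ∀ p, ∑ q, ‖h p q‖ ≤ ρ) (hcol : ∀ q, ∑ p, ‖h p q‖ ≤ ρ) :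
    (∑ p : Λ, ∑ q : Λ, h p q * ∑ σ : Fin 2, γ (orb p σ) (orb q σ)).re ≤ ρ * ((a : ℝ) + b) :=
  (Complex.re_le_norm _).trans (norm_oneBody_le_rowSum hf hrow hcol)

end Abstract

end HoppingBound

/-! ## §2 The ring: `Re E ≥ −2|t|N + U·s`, `OPT_DQG ≥ −2|t|N`, and the free-fermion floor -/

section Ring

variable {L : ℕ}
variable {γ : Matrix (Orb (Fin L)) (Orb (Fin L)) ℂ}
  {Γ : Matrix (Orb (Fin L) × Orb (Fin L)) (Orb (Fin L) × Orb (Fin L)) ℂ}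

/-- Column sums of the TV-H hopping table: `Σ_p ‖h_pq‖ ≤ 2|t|` (the table is symmetric). -/
theorem sum_norm_hubbardRingTV_h_col_le (L : ℕ) (t U : ℚ) (q : Fin L) :
    ∑ p : Fin L, ‖((hubbardRingTV L t U).h p q : ℂ)‖ ≤ 2 * |(t : ℝ)| := by
  have h := StrongCouplingGap.sum_norm_hubbardRingTV_h_le L t U q
  refine le_of_eq_of_le (Finset.sum_congr rfl fun p _ => ?_) h
  rw [(hubbardRingTV_isSymmetric L t U).1 p q]

/-- **`Re E(γ, Γ) ≥ −2|t|·(a + b) + U·s`** on every `(a, b)`-sector-feasible pair of `hubbardRingTV L t U`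
(every `L`, every sector; `s = Σ_p Re d_p`). [folklore] -/
theorem hubbardRingTV_re_rdmEnergy_ge_hop (t U : ℚ) {a b : ℕ} (hf : IsDQGFeasibleSector a b γ Γ) :
    -(2 * |(t : ℝ)| * ((a : ℝ) + b)) + (U : ℝ) * ∑ p : Fin L, (Γ (orb p 0, orb p 1) (orb p 0, orb p 1)).re ≤
      (rdmEnergy (fun p q => ((hubbardRingTV L t U).h p q : ℂ))
        (fun p q r s => ((hubbardRingTV L t U).eri p q r s : ℂ))
        ((hubbardRingTV L t U).ecore : ℂ) γ Γ).re := by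
  have hone := HoppingBound.re_oneBody_ge_neg_rowSum hf (StrongCouplingGap.sum_norm_hubbardRingTV_h_le L t U)
    (sum_norm_hubbardRingTV_h_col_le L t U)
  have htwo := StrongCouplingDoublon.interaction_eq hf.dqg.swap_fst hf.dqg.swap_snd _
    (StrongCouplingDoublon.hubbardRingTV_eri L t U)
  have hc : ((hubbardRingTV L t U).ecore : ℂ) = 0 := by simp [hubbardRingTV]
  have key : rdmEnergy (fun p q => ((hubbardRingTV L t U).h p q : ℂ))
      (fun p q r s => ((hubbardRingTV L t U).eri p q r s : ℂ)) ((hubbardRingTV L t U).ecore : ℂ) γ Γ =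
      (∑ p : Fin L, ∑ q : Fin L, ((hubbardRingTV L t U).h p q : ℂ) * ∑ σ : Fin 2, γ (orb p σ) (orb q σ)) +
        (((U : ℝ) : ℝ) : ℂ) * ∑ p : Fin L, Γ (orb p 0, orb p 1) (orb p 0, orb p 1) := by
    unfold rdmEnergy
    rw [htwo, hc, add_zero]
  rw [key, Complex.add_re, Complex.re_ofReal_mul,
    Complex.re_sum Finset.univ (fun p => Γ (orb p 0, orb p 1) (orb p 0, orb p 1))]
  linarith

/-- **`OPT_DQG(hubbardRingTV L t U; a, b) ≥ −2|t|·(a + b)`** for `U ≥ 0` (every `L`, `a, b ≤ L`).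
[folklore] -/
theorem hubbardRingTV_pqgSectorEnergy_ge_hop (t : ℚ) {U : ℚ} (hU : 0 ≤ U) {a b : ℕ} (ha : a ≤ L)
    (hb : b ≤ L) :
    -(2 * |(t : ℝ)| * ((a : ℝ) + b)) ≤ Model.pqgSectorEnergy (hubbardRingTV L t U) a b := by
  have ha' : a ≤ Fintype.card (Fin L) := by rw [Fintype.card_fin]; exact ha
  have hb' : b ≤ Fintype.card (Fin L) := by rw [Fintype.card_fin]; exact hb
  refine (le_pqgSectorEnergy_iff _ _ _ ha' hb').2 fun γ Γ hf => ?_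
  have h := hubbardRingTV_re_rdmEnergy_ge_hop t U hf
  have hs : 0 ≤ (U : ℝ) * ∑ p : Fin L, (Γ (orb p 0, orb p 1) (orb p 0, orb p 1)).re :=
    mul_nonneg (by exact_mod_cast hU) (WeakCoupling.sum_doublon_re_nonneg hf)
  linarith

/-- `E₀(hubbardRingTV L t U; a, b) ≥ −2|t|·(a + b)` for `U ≥ 0`, `a, b ≤ L`. [folklore] -/
theorem hubbardRingTV_energy_ge_hop (t : ℚ) {U : ℚ} (hU : 0 ≤ U) {a b : ℕ} (ha : a ≤ L) (hb : b ≤ L) :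
    -(2 * |(t : ℝ)| * ((a : ℝ) + b)) ≤ Model.energy (hubbardRingTV L t U) a b := by
  have ha' : a ≤ Fintype.card (Fin L) := by rw [Fintype.card_fin]; exact ha
  have hb' : b ≤ Fintype.card (Fin L) := by rw [Fintype.card_fin]; exact hb
  exact (hubbardRingTV_pqgSectorEnergy_ge_hop t hU ha hb).trans
    (pqgSectorEnergy_le_sectorGroundEnergy (hubbardRingTV_hamiltonian_isHermitian L t U) ha' hb')

/-- **THE FREE-FERMION FLOOR**: `E₀(hubbardRingTV L t 0; a, b) ≤ OPT_DQG(hubbardRingTV L t U; a, b)` for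
`U ≥ 0`, `a, b ≤ L` — the two-positivity lower bound is never below the non-interacting energy of the
same sector (`OPT_DQG` is non-decreasing in `U`, gen 36, and exact at `U = 0`, gen 38). [folklore] -/
theorem hubbardRingTV_energy_zero_le_pqgSectorEnergy (t : ℚ) {U : ℚ} (hU : 0 ≤ U) {a b : ℕ} (ha : a ≤ L)
    (hb : b ≤ L) :
    Model.energy (hubbardRingTV L t 0) a b ≤ Model.pqgSectorEnergy (hubbardRingTV L t U) a b := by
  rw [← hubbardRingTV_pqgSectorEnergy_zero_repulsion L t ha hb]
  exact StrongCouplingDoublon.hubbardRingTV_pqgSectorEnergy_mono t hU ha hb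

/-- Singlet form: `E₀(hubbardRingTV (2n) t 0; n, n) ≤ OPT_DQG+S²(hubbardRingTV (2n) t U; n)` (`U ≥ 0`,
`n ≥ 1`). [folklore] -/
theorem hubbardRingTV_energy_zero_le_pqgSingletEnergy {n : ℕ} (hn : 1 ≤ n) (t : ℚ) {U : ℚ} (hU : 0 ≤ U) :
    Model.energy (hubbardRingTV (2 * n) t 0) n n ≤ Model.pqgSingletEnergy (hubbardRingTV (2 * n) t U) n := by
  rw [← hubbardRingTV_pqgSingletEnergy_zero_repulsion hn t]
  exact StrongCouplingDoublon.hubbardRingTV_pqgSingletEnergy_mono t hU (by omega)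

end Ring

/-! ## §3 `E₀`, `OPT_DQG`, `OPT_DQG+S²` are `2(N_α + N_β)`-Lipschitz in the hopping -/

section Lipschitz

variable {L : ℕ}
variable {γ : Matrix (Orb (Fin L)) (Orb (Fin L)) ℂ}
  {Γ : Matrix (Orb (Fin L) × Orb (Fin L)) (Orb (Fin L) × Orb (Fin L)) ℂ}

/-- The hopping tables subtract: `h(t′)_pq − h(t)_pq = h(t′ − t)_pq` (the repulsion enters `h` not at all). -/
theorem hubbardRingTV_h_sub (L : ℕ) (t t' U U' : ℚ) (p q : Fin L) :
    ((hubbardRingTV L t' U').h p q : ℂ) - ((hubbardRingTV L t U).h p q : ℂ) =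
      ((hubbardRingTV L (t' - t) 0).h p q : ℂ) := by
  simp only [hubbardRingTV]
  split_ifs <;> push_cast <;> ring

/-- **The functional along the hopping**: `E_{t′,U}(γ, Γ) − E_{t,U}(γ, Γ)` is the one-body functional of
the table `h(t′ − t)` (every pair). [folklore] -/
theorem hubbardRingTV_rdmEnergy_sub_hopping (t t' U : ℚ) (γ : Matrix (Orb (Fin L)) (Orb (Fin L)) ℂ)
    (Γ : Matrix (Orb (Fin L) × Orb (Fin L)) (Orb (Fin L) × Orb (Fin L)) ℂ) :
    rdmEnergy (fun p q => ((hubbardRingTV L t' U).h p q : ℂ))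
        (fun p q r s => ((hubbardRingTV L t' U).eri p q r s : ℂ)) ((hubbardRingTV L t' U).ecore : ℂ) γ Γ -
      rdmEnergy (fun p q => ((hubbardRingTV L t U).h p q : ℂ))
        (fun p q r s => ((hubbardRingTV L t U).eri p q r s : ℂ)) ((hubbardRingTV L t U).ecore : ℂ) γ Γ =
      ∑ p : Fin L, ∑ q : Fin L, ((hubbardRingTV L (t' - t) 0).h p q : ℂ) * ∑ σ : Fin 2, γ (orb p σ) (orb q σ) := by
  have he : (fun p q r s => ((hubbardRingTV L t' U).eri p q r s : ℂ)) =
      fun p q r s => ((hubbardRingTV L t U).eri p q r s : ℂ) := rfl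
  have hc : ((hubbardRingTV L t' U).ecore : ℂ) = ((hubbardRingTV L t U).ecore : ℂ) := rfl
  unfold rdmEnergy
  rw [he, hc]
  simp only [← hubbardRingTV_h_sub L t t' U U, sub_mul, Finset.sum_sub_distrib]
  ring

/-- On a sector-feasible pair the hopping change is at most `2|t′ − t|·(a + b)` in absolute value. -/
theorem hubbardRingTV_abs_rdmEnergy_sub_hopping_le (t t' U : ℚ) {a b : ℕ} (hf : IsDQGFeasibleSector a b γ Γ) :
    |(rdmEnergy (fun p q => ((hubbardRingTV L t' U).h p q : ℂ))
        (fun p q r s => ((hubbardRingTV L t' U).eri p q r s : ℂ)) ((hubbardRingTV L t' U).ecore : ℂ) γ Γ).re -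
      (rdmEnergy (fun p q => ((hubbardRingTV L t U).h p q : ℂ))
        (fun p q r s => ((hubbardRingTV L t U).eri p q r s : ℂ)) ((hubbardRingTV L t U).ecore : ℂ) γ Γ).re| ≤
      2 * |(t' : ℝ) - t| * ((a : ℝ) + b) := by
  rw [← Complex.sub_re, hubbardRingTV_rdmEnergy_sub_hopping]
  refine (Complex.abs_re_le_norm _).trans ?_
  have h := HoppingBound.norm_oneBody_le_rowSum hf
    (StrongCouplingGap.sum_norm_hubbardRingTV_h_le L (t' - t) 0) (sum_norm_hubbardRingTV_h_col_le L (t' - t) 0)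
  simpa [Rat.cast_sub] using h

/-- **`E₀` IS `2(N_α + N_β)`-LIPSCHITZ IN THE HOPPING**:
`|E₀(hubbardRingTV L t U; a, b) − E₀(hubbardRingTV L t′ U; a, b)| ≤ 2|t − t′|·(a + b)` (`a, b ≤ L`, every
`U`) — ground states as trial states across, their reduced density matrices sector-feasible. [folklore] -/
theorem abs_hubbardRingTV_energy_sub_le_hop (t t' U : ℚ) {a b : ℕ} (ha : a ≤ L) (hb : b ≤ L) :
    |Model.energy (hubbardRingTV L t U) a b - Model.energy (hubbardRingTV L t' U) a b| ≤
      2 * |(t : ℝ) - t'| * ((a : ℝ) + b) := by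
  have ha' : a ≤ Fintype.card (Fin L) := by rw [Fintype.card_fin]; exact ha
  have hb' : b ≤ Fintype.card (Fin L) := by rw [Fintype.card_fin]; exact hb
  -- one direction, for arbitrary hoppings `s, s'`: `E₀(s') ≤ E₀(s) + 2|s' − s|(a+b)`
  have step : ∀ s s' : ℚ, Model.energy (hubbardRingTV L s' U) a b ≤
      Model.energy (hubbardRingTV L s U) a b + 2 * |(s' : ℝ) - s| * ((a : ℝ) + b) := by
    intro s s'
    obtain ⟨ψ, hψ, hψ1, hHψ⟩ :=
      exists_unit_eigen_sectorGroundEnergy (hubbardRingTV_hamiltonian_isHermitian L s U) ha' hb'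
    have hf := IsDQGFeasibleSector.of_state hψ hψ1
    have hEs : (rdmEnergy (fun p q => ((hubbardRingTV L s U).h p q : ℂ))
        (fun p q r w => ((hubbardRingTV L s U).eri p q r w : ℂ))
        ((hubbardRingTV L s U).ecore : ℂ) (oneRDM ψ) (twoRDM ψ)).re = Model.energy (hubbardRingTV L s U) a b := by
      rw [rdmEnergy_rdm _ _ _ hψ1, hHψ, dotProduct_smul, hψ1, smul_eq_mul, mul_one, Complex.ofReal_re]
      rfl
    have hRR : Model.energy (hubbardRingTV L s' U) a b ≤
        (rdmEnergy (fun p q => ((hubbardRingTV L s' U).h p q : ℂ))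
          (fun p q r w => ((hubbardRingTV L s' U).eri p q r w : ℂ))
          ((hubbardRingTV L s' U).ecore : ℂ) (oneRDM ψ) (twoRDM ψ)).re := by
      rw [rdmEnergy_rdm _ _ _ hψ1]
      exact sectorGroundEnergy_le_re_rayleigh_of_unit (hubbardRingTV_hamiltonian_isHermitian L s' U) hψ hψ1
    have hdiff := hubbardRingTV_abs_rdmEnergy_sub_hopping_le (L := L) s s' U hf
    rw [hEs, abs_le] at hdiff
    linarith [hdiff.2]
  rw [abs_le]
  constructor
  · have h := step t t'
    rw [abs_sub_comm] at h
    linarith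
  · have h := step t' t
    linarith

/-- **`OPT_DQG` IS `2(N_α + N_β)`-LIPSCHITZ IN THE HOPPING**:
`|OPT_DQG(L; t, U; a, b) − OPT_DQG(L; t′, U; a, b)| ≤ 2|t − t′|·(a + b)` (`a, b ≤ L`, every `U`) — optimal
pairs as witnesses across (the feasible set does not depend on `t`). [folklore] -/
theorem abs_hubbardRingTV_pqgSectorEnergy_sub_le_hop (t t' U : ℚ) {a b : ℕ} (ha : a ≤ L) (hb : b ≤ L) :
    |Model.pqgSectorEnergy (hubbardRingTV L t U) a b - Model.pqgSectorEnergy (hubbardRingTV L t' U) a b| ≤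
      2 * |(t : ℝ) - t'| * ((a : ℝ) + b) := by
  have ha' : a ≤ Fintype.card (Fin L) := by rw [Fintype.card_fin]; exact ha
  have hb' : b ≤ Fintype.card (Fin L) := by rw [Fintype.card_fin]; exact hb
  have step : ∀ s s' : ℚ, Model.pqgSectorEnergy (hubbardRingTV L s' U) a b ≤
      Model.pqgSectorEnergy (hubbardRingTV L s U) a b + 2 * |(s' : ℝ) - s| * ((a : ℝ) + b) := by
    intro s s'
    obtain ⟨γ, Γ, hf, hE⟩ := exists_isDQGFeasibleSector_rdmEnergy_eq_pqgSectorEnergy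
      (fun p q => ((hubbardRingTV L s U).h p q : ℂ))
      (fun p q r w => ((hubbardRingTV L s U).eri p q r w : ℂ)) ((hubbardRingTV L s U).ecore : ℂ) ha' hb'
    have hle := pqgSectorEnergy_le_rdmEnergy (fun p q => ((hubbardRingTV L s' U).h p q : ℂ))
      (fun p q r w => ((hubbardRingTV L s' U).eri p q r w : ℂ)) ((hubbardRingTV L s' U).ecore : ℂ) hf
    have hdiff := hubbardRingTV_abs_rdmEnergy_sub_hopping_le (L := L) s s' U hf
    rw [hE, abs_le] at hdiff
    unfold Model.pqgSectorEnergy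
    linarith [hdiff.2]
  rw [abs_le]
  constructor
  · have h := step t t'
    rw [abs_sub_comm] at h
    linarith
  · have h := step t' t
    linarith

/-- **`OPT_DQG+S²` IS `2(N_α + N_β)`-LIPSCHITZ IN THE HOPPING**: `|OPT_DQG+S²(L; t, U; n) − OPT_DQG+S²(L; t′, U; n)|
≤ 2|t − t′|·(2n)` (`n ≤ L`, every `U`). [folklore] -/
theorem abs_hubbardRingTV_pqgSingletEnergy_sub_le_hop (t t' U : ℚ) {n : ℕ} (hn : n ≤ L) :
    |Model.pqgSingletEnergy (hubbardRingTV L t U) n - Model.pqgSingletEnergy (hubbardRingTV L t' U) n| ≤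
      2 * |(t : ℝ) - t'| * ((n : ℝ) + n) := by
  have hn' : n ≤ Fintype.card (Fin L) := by rw [Fintype.card_fin]; exact hn
  have step : ∀ s s' : ℚ, Model.pqgSingletEnergy (hubbardRingTV L s' U) n ≤
      Model.pqgSingletEnergy (hubbardRingTV L s U) n + 2 * |(s' : ℝ) - s| * ((n : ℝ) + n) := by
    intro s s'
    obtain ⟨γ, Γ, hf, hE⟩ := exists_isDQGFeasibleSinglet_rdmEnergy_eq_pqgSingletEnergy
      (fun p q => ((hubbardRingTV L s U).h p q : ℂ))
      (fun p q r w => ((hubbardRingTV L s U).eri p q r w : ℂ)) ((hubbardRingTV L s U).ecore : ℂ) hn'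
    have hle := pqgSingletEnergy_le_rdmEnergy (fun p q => ((hubbardRingTV L s' U).h p q : ℂ))
      (fun p q r w => ((hubbardRingTV L s' U).eri p q r w : ℂ)) ((hubbardRingTV L s' U).ecore : ℂ) hf
    have hdiff := hubbardRingTV_abs_rdmEnergy_sub_hopping_le (L := L) s s' U hf.toIsDQGFeasibleSector
    rw [hE, abs_le] at hdiff
    unfold Model.pqgSingletEnergy
    linarith [hdiff.2]
  rw [abs_le]
  constructor
  · have h := step t t'
    rw [abs_sub_comm] at h
    linarith
  · have h := step t' t
    linarith

end Lipschitz

end Summit.Ventures.CertifiedQuantumChemistry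

end
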